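import Literature.NumberTheory.EllipticCurves.Kim2025.FineMainIdentityOffP
import HarnessLib

/-!
# C.-H. Kim, arXiv:2505.09121v1, §3.5.2 for an elliptic curve over Kato's §17.13 package:
# Thm. 3.15 (Kato–Rohrlich, non-triviality of the `Λ`-adic zeta elements) and Thm. 3.16 (1)
# (Kato Thm. 12.4 (2)) as KERNEL THEOREMS — `𝐇¹_Γ(T_pW)` is finitely generated torsion-free of
# rank one, `p^n·L_p(E,T)` kills `𝐇¹_Γ/Z`, `Z ≠ 0`, `𝐇¹_Γ/Z` is `Λ`-torsion — and Thm. 3.18 (1) at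
# the height-one primes `𝔭 ∌ p` WITHOUT any image hypothesis (Kato Thm. 12.5 (3)) (theorems only)

Topic `NumberTheory/EllipticCurves`, sub-directory `Kim2025`; namespace
`Literature.NumberTheory.EllipticCurves.Kim2025`.  Typing layer (cell `bsd-littype`, seat 09, gen 5);
companion of the gen-4 fine-currency files (`MainIdentityAtAugmentationFineDictionary`,
`FineOneSidedDivisibility`, `FineMainIdentityOffP`, `FineMainIdentitySkinnerUrban`).  HONEST
FRAMING: THEOREMS ONLY (0 definitions, 0 named facts, net debt 0); everything is proved over a
§17.13 package `K : Kato2004.DivisibilityInputs W p f κ γ I D` (the tree's hypothesis structure of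
Kato's printed statements; inhabited by the named fact `Kato2004.exists_divisibilityInputs` /
`exists_divisibilityInputs_fineQuotient`, which are NOT consumed except in the two closing
`exists_…_of_fineQuotient` instances, by name); the one research input used silently is Rohrlich's
theorem `L_p(E,T) ≠ 0` in the tree form `padicLFunction_unitRoot_ne_zero` (a tree THEOREM over the
refereed fact `padicLFunction_ne_zero_holds`).  BSD is not advanced; nothing is booked.

## The printed statements (held text `paper:arxiv-2505.09121`, §3.5.2–§3.5.3, chunk p0014)

> **Theorem 3.15 (Kato–Rohrlich).** Kato's zeta element `κ^{Kato,k−r,∞}_1 = z^{Kato,k−r}_{ℚ_∞}`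
> over `ℚ_∞` is non-trivial.  *Proof.* By using Kato's explicit reciprocity law, the conclusion
> follows from the generic non-vanishing of twisted `L`-values [Rohrlich]. (p0014:L16–L21)
>
> **Theorem 3.16 (Kato).** Suppose that `ρ̄_f` is irreducible. Then: (1) `H¹_Iw(ℚ, T_f(k−r))` is
> free of rank one over `Λ`. (2) `Sel₀(ℚ_∞, W_{f̄}(r))^∨` is a finitely generated torsion
> `Λ`-module. (p0014:L25–L33)
>
> **Theorem 3.18 (Kato, Mazur–Rubin).** Assume that `ρ_f` has large image. … (1) The one-sided
> divisibility `char_Λ(H¹_Iw/Λκ^{Kato,∞}_1) ⊆ char_Λ(Sel₀(ℚ_∞,W(r))^∨)` holds. (p0014:L53–L59)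

and Kato's originals (held text `paper:url-37fbba0bb64a`, file page = printed page − 115):

> **Thm. 12.4 (2)** `H¹(T)` is a torsion free `Λ`-module, and `H¹(T) ⊗ ℚ = H¹(V_{F_λ}(f))` is a
> free `Λ ⊗ ℚ`-module of rank `1`. (p. 221)  **Thm. 12.5 (2)** `H¹(V_{F_λ}(f))/Z(f)` is a torsion
> `Λ ⊗ ℚ`-module. **(3)** Let `𝔭` be a prime ideal of `Λ` of height one which does not contain
> `p`. Then `length_{Λ_𝔭}(H²(V)_𝔭) ≤ length_{Λ_𝔭}(H¹(V)_𝔭/Z(f)_𝔭) + length_{Λ_𝔭}(H²_loc(V)_𝔭)`.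
> (p. 222)  **Thm. 12.6** `Z ⊂ Z(f,T)` and `Z(f,T)/Z` is a finite group. (p. 222)

## What is proved, for `E/ℚ` (`k = 2`, `r = 1`, `T ≅ T_pW(−1)`) at a good ordinary odd `p`

Over a package `K` (reading of the companions: `I.H = 𝐇¹_Γ(T_pW)` pinned, `K.Z` = Kato's `Z` of
Thm. 12.6 projected to the `Δ`-trivial component — Kim's `Λκ^{Kato,∞}_1` up to the finite index
of Thm. 12.6 —, `K.G ∈ col(loc Z)` with `ι G = p^n · L_p(E,T)`, fine quotient `π : X ↠ Y`):

* `colLoc_injective`, `moduleFinite_H1_of_package`, `isTorsionFree_H1_of_package`,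
  `rank_H1_le_one_of_package` — `𝐇¹_Γ ↪ Λ` via `col ∘ loc` ((17.13.2) + Prop. 17.11), so `𝐇¹_Γ`
  is finitely generated, torsion free, of rank `≤ 1` (**Thm. 3.16 (1) = Kato 12.4 (2) E-shadow**;
  FREENESS — the `ρ̄` irreducible clause, Kato 12.4 (3) — is NOT derived: WEAKER than print).
  `moduleFinite_H1_of_package` discharges BY NAME the instance binder `[Module.Finite Λ I.H]` of
  the companion theorem `exists_integralZeta_charIdeal_le_charIdeal_fine` (no `thm12_4` needed).
* `colLoc_smul_comm`, `G_smul_mem_zeta`, `isTorsionBy_G_quotient_zeta` — **`p^n·L_p(E,T)` kills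
  `𝐇¹_Γ/Z`** (pure algebra of the package: `Z` and `𝐇¹` sit inside the commutative ring `Λ`).
* `G_ne_zero` (Rohrlich: `L_p(E,T) ≠ 0`), `zeta_ne_bot`, `isTorsion_quotient_zeta`,
  `rank_H1_eq_one_of_package`, `lengthAt_quotient_zeta_ne_top` — **Thm. 3.15 (Kato–Rohrlich)
  E-shadow: `Z ≠ 0`, `𝐇¹_Γ/Z` is `Λ`-torsion (Kato 12.5 (2), integrally), `rank_Λ 𝐇¹_Γ = 1`,
  `ℓ_𝔭(𝐇¹_Γ/Z) < ∞` at every height-one `𝔭`.**  As in print, the non-vanishing input is Rohrlich's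
  theorem; the explicit reciprocity law is inside the package field `ιG_eq`/`pow_mem` (16.6 (2)).
* `lengthAt_fine_le_lengthAt_quotient_zeta_offP` — **Thm. 3.18 (1) at every height-one `𝔭 ∌ p`
  for EVERY package, with NO image hypothesis: `ℓ_𝔭(Y) ≤ ℓ_𝔭(𝐇¹_Γ/Z)`** (= Kato Thm. 12.5 (3)
  composed with (17.13.1), (17.13.4); [K25] Thm. 3.18 assumes large image and then gets every
  `𝔭` — that form is the companion `exists_integralZeta_lengthAt_fine_le` under tower
  surjectivity; the present clause is what survives without it).
* `exists_isTorsion_quotient_zeta_of_fineQuotient`, `exists_lengthAt_fineSelmerDual_le_offP_of_fineQuotient`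
  — the instances on the pinned `W.FineSelmerDualData`, modulo `exists_divisibilityInputs_fineQuotient`
  by name.

## References
* C.-H. Kim (app. with R. Pollack), arXiv:2505.09121v1 (2025), Thm. 3.15, Thm. 3.16, Thm. 3.18 (1)
  (§3.5.2–3.5.3). [Kim2025RefinedTNC]
* K. Kato, Astérisque 295 (2004), Thm. 12.4 (2) (p. 221), Thm. 12.5 (2)(3), Thm. 12.6 (p. 222),
  Thm. 16.6 (p. 271), Prop. 17.11 (p. 277), §17.13 (pp. 279–280). [Kato2004Asterisque]
* D. Rohrlich, Invent. Math. 75 (1984), Theorem (p. 409). [RohrlichInventiones1984]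
* J. Neukirch, A. Schmidt, K. Wingberg, *Cohomology of Number Fields*, Ch. V §1 (structure of
  finitely generated `Λ`-modules; ranks and torsion). [NeukirchSchmidtWingberg2008]
-/

noncomputable section

open scoped MatrixGroups ModularForm Classical

open CongruenceSubgroup Literature.NumberTheory.EllipticCurves.ModularForms
  Literature.NumberTheory.EllipticCurves Literature.NumberTheory.EllipticCurves.Module
  Literature.NumberTheory.EllipticCurves.IwasawaAlgebra
open Field Literature.NumberTheory.GaloisRepresentations
open Literature.NumberTheory.EllipticCurves.Kato2004
open Literature.NumberTheory.EllipticCurves.Kato2004.EulerSystemValues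

universe u

namespace Literature.NumberTheory.EllipticCurves.Kim2025

section Package

variable {p : ℕ} [Fact p.Prime] {W : WeierstrassCurve ℚ} [W.IsElliptic] [W.IsGloballyMinimal]
  [ContinuousSMul ℤ_[p] (W.tateModule p)] {N : ℕ} [NeZero N] {f : CuspForm (Gamma0 N) 2}
  {κ : ZpExtension ℚ p} {γ : absoluteGaloisGroup ℚ}
  {I : IwasawaH1Data W p κ γ} {D : W.SelmerDualData κ γ}
  {Y : Type u} [AddCommGroup Y] [_root_.Module (IwasawaAlgebra p) Y]

/-! ### `𝐇¹_Γ(T_pW)` sits inside `Λ` -/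

omit [NeZero N] in
/-- `col ∘ loc : 𝐇¹_Γ(T_pW) → Λ` is injective: `𝐇¹ ↪ P` by (17.13.2) (`lim← H¹_f = 0`) and the
Coleman map `P ↪ Λ` of Prop. 17.11. [cite: Kato2004Asterisque, §17.13 (17.13.2) (p. 279) and Prop. 17.11 (p. 277)] -/
theorem colLoc_injective (K : DivisibilityInputs W p f κ γ I D) :
    Function.Injective (K.col ∘ₗ K.loc) :=
  K.col_injective.comp K.loc_injective

omit [NeZero N] in
/-- **`𝐇¹_Γ(T_pW)` is a finitely generated `Λ`-module** (it embeds in the Noetherian ring `Λ`; Kato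
(12.2.1) for `E`, here a CONSEQUENCE of the package, no `thm12_4` needed).
[cite: Kato2004Asterisque, (12.2.1) (p. 220), §17.13 (p. 279)] -/
theorem moduleFinite_H1_of_package (K : DivisibilityInputs W p f κ γ I D) :
    Module.Finite (IwasawaAlgebra p) I.H :=
  Module.Finite.of_injective (K.col ∘ₗ K.loc) (colLoc_injective K)

omit [NeZero N] in
/-- **`𝐇¹_Γ(T_pW)` is torsion free over `Λ`** (it embeds in the domain `Λ`) — [K25] Thm. 3.16 (1) /
Kato Thm. 12.4 (2), first clause, for `E` over the package.
[cite: Kim2025RefinedTNC, Thm. 3.16 (1) (§3.5.2, chunk p0014:L25–L30)]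
[cite: Kato2004Asterisque, Thm. 12.4 (2) (p. 221)] -/
theorem isTorsionFree_H1_of_package (K : DivisibilityInputs W p f κ γ I D) :
    Module.IsTorsionFree (IwasawaAlgebra p) I.H :=
  (colLoc_injective K).moduleIsTorsionFree _ fun r m ↦ map_smul _ r m

omit [NeZero N] in
/-- `rank_Λ 𝐇¹_Γ(T_pW) ≤ 1` (a submodule of `Λ`). [cite: Kato2004Asterisque, Thm. 12.4 (2) (p. 221)] -/
theorem rank_H1_le_one_of_package (K : DivisibilityInputs W p f κ γ I D) :
    Module.rank (IwasawaAlgebra p) I.H ≤ 1 := by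
  rw [← Module.rank_self (IwasawaAlgebra p)]
  exact LinearMap.rank_le_of_injective _ (colLoc_injective K)

/-! ### `p^n · L_p(E,T)` kills `𝐇¹_Γ/Z` -/

omit [NeZero N] in
/-- Inside `Λ` multiplication commutes: for `h, z ∈ 𝐇¹_Γ`, `col(loc z) • h = col(loc h) • z`
(both have image `col(loc h) · col(loc z)` under the injection `col ∘ loc`). [cite: Kato2004Asterisque, §17.13 (p. 279)] -/
theorem colLoc_smul_comm (K : DivisibilityInputs W p f κ γ I D) (h z : I.H) :
    K.col (K.loc z) • h = K.col (K.loc h) • z := by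
  apply colLoc_injective K
  simp only [LinearMap.comp_apply, map_smul, smul_eq_mul]
  exact mul_comm _ _

omit [NeZero N] in
/-- **`G • h ∈ Z` for every `h ∈ 𝐇¹_Γ`**, where `G = p^n · L_p(E,T) ∈ col(loc Z)` is the package's
element of Thm. 16.6 (2): writing `G = col(loc z₀)` with `z₀ ∈ Z`, `G • h = col(loc h) • z₀ ∈ Z`.
[cite: Kato2004Asterisque, Thm. 16.6 (2) (p. 271) and §17.13 (p. 279)] -/
theorem G_smul_mem_zeta (K : DivisibilityInputs W p f κ γ I D) (h : I.H) : K.G • h ∈ K.Z := by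
  obtain ⟨z, hz, hGz⟩ := Submodule.mem_map.mp K.pow_mem
  rw [← hGz, LinearMap.comp_apply, colLoc_smul_comm K h z]
  exact K.Z.smul_mem _ hz

omit [NeZero N] in
/-- **`𝐇¹_Γ/Z` is killed by `G = p^n · L_p(E,T)`.** [cite: Kato2004Asterisque, Thm. 12.5 (2), Thm. 12.6 (p. 222), Thm. 16.6 (2) (p. 271)] -/
theorem isTorsionBy_G_quotient_zeta (K : DivisibilityInputs W p f κ γ I D) :
    Module.IsTorsionBy (IwasawaAlgebra p) (I.H ⧸ K.Z) K.G :=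
  (Module.isTorsionBy_quotient_iff K.Z K.G).mpr fun h ↦ G_smul_mem_zeta K h

/-! ### Thm. 3.15 (Kato–Rohrlich): the zeta submodule is non-trivial -/

/-- **`G = p^n · L_p(E,T) ≠ 0` in `Λ`** — Rohrlich's generic non-vanishing of twisted `L`-values in
the tree form `L_p(E,T) ≠ 0` (`padicLFunction_unitRoot_ne_zero`), transported along
`ι G = p^n · L_p(E,T)`. [cite: Kim2025RefinedTNC, Thm. 3.15 and its proof (§3.5.2, chunk p0014:L16–L21)]
[cite: RohrlichInventiones1984, Theorem (p. 409)] [cite: Kato2004Asterisque, Thm. 16.6 (2) (p. 271)] -/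
theorem G_ne_zero (K : DivisibilityInputs W p f κ γ I D) (hord : IsOrdinaryAt W p)
    (hf : IsNewformOf W f) : K.G ≠ 0 := by
  intro h0
  have h := K.ιG_eq
  rw [h0, map_zero] at h
  rcases mul_eq_zero.mp h.symm with hC | hL
  · rw [map_eq_zero_iff _ PowerSeries.C_injective] at hC
    exact pow_ne_zero _ (Nat.cast_ne_zero.mpr (Fact.out : p.Prime).ne_zero) hC
  · exact padicLFunction_unitRoot_ne_zero hord hf hL

/-- **[K25] Thm. 3.15 (Kato–Rohrlich) for `E`, over the package: the zeta submodule `Z ≤ 𝐇¹_Γ(T_pW)`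
is non-zero** (`G ∈ col(loc Z)` and `G ≠ 0`).
[cite: Kim2025RefinedTNC, Thm. 3.15 (§3.5.2, chunk p0014:L16–L21)]
[cite: Kato2004Asterisque, Thm. 12.5 (1)(2), Thm. 12.6 (p. 222)] [cite: RohrlichInventiones1984, Theorem (p. 409)] -/
theorem zeta_ne_bot (K : DivisibilityInputs W p f κ γ I D) (hord : IsOrdinaryAt W p)
    (hf : IsNewformOf W f) : K.Z ≠ ⊥ := by
  intro hZ
  apply G_ne_zero K hord hf
  have h := K.pow_mem
  rwa [hZ, Submodule.map_bot, Submodule.mem_bot] at h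

/-- **`𝐇¹_Γ(T_pW)/Z` is a TORSION `Λ`-module** (killed by `p^n · L_p(E,T) ≠ 0`) — Kato Thm. 12.5 (2)
for `E`, integrally through `Z` (Thm. 12.6), i.e. the form of Thm. 3.15 used in the proof of
Thm. 3.18 ("Theorem 3.15 is essential in the proof").
[cite: Kim2025RefinedTNC, Thm. 3.15, proof of Thm. 3.18 (§3.5.2–3.5.3, chunk p0014:L16–L21, L72)]
[cite: Kato2004Asterisque, Thm. 12.5 (2) and Thm. 12.6 (p. 222)] [cite: RohrlichInventiones1984, Theorem (p. 409)] -/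
theorem isTorsion_quotient_zeta (K : DivisibilityInputs W p f κ γ I D) (hord : IsOrdinaryAt W p)
    (hf : IsNewformOf W f) : Module.IsTorsion (IwasawaAlgebra p) (I.H ⧸ K.Z) := by
  have hby := isTorsionBy_G_quotient_zeta K
  exact fun x ↦ ⟨⟨K.G, mem_nonZeroDivisors_of_ne_zero (G_ne_zero K hord hf)⟩, @hby x⟩

/-- **`rank_Λ 𝐇¹_Γ(T_pW) = 1`** — [K25] Thm. 3.16 (1) / Kato Thm. 12.4 (2) for `E` over the
package, WITHOUT the freeness clause: `≤ 1` as a submodule of `Λ`, `≥ 1` because `Z ≠ 0`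
(Thm. 3.15) gives a non-zero `z ∈ 𝐇¹_Γ`, and `r ↦ r • z` is injective (torsion free over a domain).
[cite: Kim2025RefinedTNC, Thm. 3.16 (1) (§3.5.2, chunk p0014:L25–L30)]
[cite: Kato2004Asterisque, Thm. 12.4 (2) (p. 221)] [cite: RohrlichInventiones1984, Theorem (p. 409)] -/
theorem rank_H1_eq_one_of_package (K : DivisibilityInputs W p f κ γ I D) (hord : IsOrdinaryAt W p)
    (hf : IsNewformOf W f) : Module.rank (IwasawaAlgebra p) I.H = 1 := by
  refine le_antisymm (rank_H1_le_one_of_package K) ?_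
  obtain ⟨z, -, hz0⟩ := Submodule.exists_mem_ne_zero_of_ne_bot (zeta_ne_bot K hord hf)
  haveI := isTorsionFree_H1_of_package K
  have hinj : Function.Injective (LinearMap.toSpanSingleton (IwasawaAlgebra p) I.H z) := by
    intro r₁ r₂ h
    simp only [LinearMap.toSpanSingleton_apply] at h
    exact smul_left_injective (IwasawaAlgebra p) hz0 h
  rw [← Module.rank_self (IwasawaAlgebra p)]
  exact LinearMap.rank_le_of_injective _ hinj

/-- `𝐇¹_Γ/Z` has FINITE local length at every height-one prime `𝔭` of `Λ` (finitely generated and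
killed by `G ≠ 0`; tree lemma `lengthAt_ne_top_of_isTorsionBy`).
[cite: Kato2004Asterisque, Thm. 12.5 (2), Thm. 12.6 (p. 222)] [cite: NeukirchSchmidtWingberg2008, Ch. V §1 (5.1.4)] -/
theorem lengthAt_quotient_zeta_ne_top (K : DivisibilityInputs W p f κ γ I D)
    (hord : IsOrdinaryAt W p) (hf : IsNewformOf W f) (𝔭 : PrimeSpectrum (IwasawaAlgebra p))
    (h𝔭 : 𝔭.asIdeal.height = 1) : lengthAt (IwasawaAlgebra p) (I.H ⧸ K.Z) 𝔭 ≠ ⊤ := by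
  haveI := moduleFinite_H1_of_package K
  exact lengthAt_ne_top_of_isTorsionBy (G_ne_zero K hord hf) (isTorsionBy_G_quotient_zeta K) 𝔭
    h𝔭.le

/-! ### Thm. 3.18 (1) at the height-one primes `𝔭 ∌ p`, no image hypothesis (Kato Thm. 12.5 (3)) -/

omit [NeZero N] in
/-- **Kato Thm. 12.5 (3) with (17.13.1), (17.13.4), for EVERY package and with NO image hypothesis:
`ℓ_𝔭(Y) ≤ ℓ_𝔭(𝐇¹_Γ/Z)` at every height-one prime `𝔭 ∌ p`**, for the fine quotient `π : X ↠ Y`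
(`ℓ_𝔭(Y) = ℓ_𝔭(𝐇²)` off `(p)` since `𝐇²_loc` is finite; then the printed inequality
`ℓ_𝔭(𝐇²) ≤ ℓ_𝔭(𝐇¹/Z) + ℓ_𝔭(𝐇²_loc)` with `ℓ_𝔭(𝐇²_loc) = 0`).  This is the part of [K25] Thm. 3.18 (1)
that survives WITHOUT "large image"; the all-`𝔭` form under tower surjectivity is the companion
`exists_integralZeta_lengthAt_fine_le`. [cite: Kato2004Asterisque, Thm. 12.5 (3) (p. 222), §17.13 (17.13.1), (17.13.4) (p. 279)]
[cite: Kim2025RefinedTNC, Thm. 3.18 (1) (§3.5.3, chunk p0014:L53–L59)] -/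
theorem lengthAt_fine_le_lengthAt_quotient_zeta_offP (K : DivisibilityInputs W p f κ γ I D)
    (π : D.X →ₗ[IwasawaAlgebra p] Y) (hπs : Function.Surjective π) (hπ : Function.Exact K.toX π)
    (𝔭 : PrimeSpectrum (IwasawaAlgebra p)) (h𝔭 : 𝔭.asIdeal.height = 1)
    (hp𝔭 : PowerSeries.C (p : ℤ_[p]) ∉ 𝔭.asIdeal) :
    lengthAt (IwasawaAlgebra p) Y 𝔭 ≤ lengthAt (IwasawaAlgebra p) (I.H ⧸ K.Z) 𝔭 := by
  have h := K.es_bound 𝔭 h𝔭 hp𝔭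
  haveI := K.finite_H2loc
  rw [lengthAt_eq_zero_of_finite_of_C_not_mem K.H2loc 𝔭 hp𝔭, add_zero] at h
  rwa [lengthAt_fine_eq_lengthAt_H2_offP K π hπs hπ 𝔭 hp𝔭]

end Package

/-! ### The instances on the pinned fine Selmer dual -/

section FineSelmerDual

variable {p : ℕ} [Fact p.Prime] {W : WeierstrassCurve ℚ} [W.IsElliptic] [W.IsGloballyMinimal]
  [ContinuousSMul ℤ_[p] (W.tateModule p)] {N : ℕ} [NeZero N] {f : CuspForm (Gamma0 N) 2}
  {κ : ZpExtension ℚ p} {γ : absoluteGaloisGroup ℚ}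

/-- **[K25] Thm. 3.15 / 3.16 (1) for `E/ℚ` at a good ordinary odd `p`, on the pinned
`𝐇¹_Γ(T_pW) = I.H`, MODULO the named fact `Kato2004.exists_divisibilityInputs_fineQuotient`:** there is a
package `K` (with a fine quotient onto `X₀ = Y.X`) such that `𝐇¹_Γ` is finitely generated torsion free
of rank one, `K.Z ≠ 0`, and `𝐇¹_Γ/K.Z` is `Λ`-torsion, killed by `K.G` with `ι K.G = p^n · L_p(E,T)`.
[cite: Kim2025RefinedTNC, Thm. 3.15, Thm. 3.16 (1) (§3.5.2, chunk p0014:L16–L30)]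
[cite: Kato2004Asterisque, Thm. 12.4 (2) (p. 221), Thm. 12.5 (2), 12.6 (p. 222), (14.9.3) (p. 240), §17.13 (pp. 279–280)]
[cite: RohrlichInventiones1984, Theorem (p. 409)] -/
theorem exists_isTorsion_quotient_zeta_of_fineQuotient
    (hfine : exists_divisibilityInputs_fineQuotient) (hp : p ≠ 2) (hord : IsOrdinaryAt W p)
    (hκ : κ.IsCyclotomic) (hγ : κ.IsTopGenerator γ) (hγ' : IsCyclotomicVariable p γ)
    (hf : IsNewformOf W f)
    (I : IwasawaH1Data W p κ γ) (D : W.SelmerDualData κ γ) (Y : W.FineSelmerDualData κ γ) :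
    ∃ (K : DivisibilityInputs W p f κ γ I D) (π : D.X →ₗ[IwasawaAlgebra p] Y.X),
      Function.Surjective π ∧ Function.Exact K.toX π ∧
      Module.Finite (IwasawaAlgebra p) I.H ∧ Module.IsTorsionFree (IwasawaAlgebra p) I.H ∧
      Module.rank (IwasawaAlgebra p) I.H = 1 ∧ K.Z ≠ ⊥ ∧
      Module.IsTorsionBy (IwasawaAlgebra p) (I.H ⧸ K.Z) K.G ∧
      Module.IsTorsion (IwasawaAlgebra p) (I.H ⧸ K.Z) := by
  obtain ⟨K, π, hπs, hπ⟩ := hfine W p f κ γ hp hord hκ hγ hγ' hf I D Y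
  exact ⟨K, π, hπs, hπ, moduleFinite_H1_of_package K, isTorsionFree_H1_of_package K,
    rank_H1_eq_one_of_package K hord hf, zeta_ne_bot K hord hf, isTorsionBy_G_quotient_zeta K,
    isTorsion_quotient_zeta K hord hf⟩

/-- **[K25] Thm. 3.18 (1) off `(p)` WITHOUT large image (Kato Thm. 12.5 (3)) for `E/ℚ` at a good
ordinary odd `p`, on the pinned `𝐇¹_Γ(T_pW)` and `X₀(E/ℚ_∞) = Y.X`, MODULO
`Kato2004.exists_divisibilityInputs_fineQuotient`:** there are a package `K` and a fine quotient
`π : X ↠ X₀` with `ℓ_𝔭(X₀) ≤ ℓ_𝔭(𝐇¹_Γ/K.Z)` at every height-one prime `𝔭 ∌ p`.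
[cite: Kato2004Asterisque, Thm. 12.5 (3) (p. 222), (14.9.3) (p. 240), §17.13 (pp. 279–280)]
[cite: Kim2025RefinedTNC, Thm. 3.18 (1) (§3.5.3, chunk p0014:L53–L59)] -/
theorem exists_lengthAt_fineSelmerDual_le_offP_of_fineQuotient
    (hfine : exists_divisibilityInputs_fineQuotient) (hp : p ≠ 2) (hord : IsOrdinaryAt W p)
    (hκ : κ.IsCyclotomic) (hγ : κ.IsTopGenerator γ) (hγ' : IsCyclotomicVariable p γ)
    (hf : IsNewformOf W f)
    (I : IwasawaH1Data W p κ γ) (D : W.SelmerDualData κ γ) (Y : W.FineSelmerDualData κ γ) :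
    ∃ (K : DivisibilityInputs W p f κ γ I D) (π : D.X →ₗ[IwasawaAlgebra p] Y.X),
      Function.Surjective π ∧ Function.Exact K.toX π ∧
      ∀ 𝔭 : PrimeSpectrum (IwasawaAlgebra p), 𝔭.asIdeal.height = 1 →
        PowerSeries.C (p : ℤ_[p]) ∉ 𝔭.asIdeal →
          lengthAt (IwasawaAlgebra p) Y.X 𝔭 ≤ lengthAt (IwasawaAlgebra p) (I.H ⧸ K.Z) 𝔭 := by
  obtain ⟨K, π, hπs, hπ⟩ := hfine W p f κ γ hp hord hκ hγ hγ' hf I D Y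
  exact ⟨K, π, hπs, hπ, fun 𝔭 h𝔭 hp𝔭 ↦
    lengthAt_fine_le_lengthAt_quotient_zeta_offP K π hπs hπ 𝔭 h𝔭 hp𝔭⟩

end FineSelmerDual

end Literature.NumberTheory.EllipticCurves.Kim2025

end
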